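import Mathlib.Analysis.SpecialFunctions.Pow.Real
import Mathlib.Tactic.LinearCombination
import Literature.Computability.AlgebraicComplexity.BorderRankCW
import HarnessLib

/-!
# Proof of `bR(T_{skewcw,2}^{⊠2}) ≤ 17` (CGLV 2022, §1.3) from the explicit expression of CHL 2020

Topic: `Literature/Computability/AlgebraicComplexity`. Sibling of `BorderRankCW.lean` (and of
`BorderRankCWProofs.lean`, which proves Lemma 2.4 and Thm. 4.1 of the same paper); this file
discharges the named fact `CGLV2022_borderRank_skewCw2_sq_le` of `BorderRankCW.lean`:
`algBorderRank (kroneckerPow (skewCwTensor ℂ 1) 2) ≤ 17` (Conner–Gesmundo–Landsberg–Ventura,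
arXiv:1909.04785v2, §1.3; Thm. 2.7 of the journal version), by a kernel-checked explicit order-`15`
approximate decomposition with `17` triads over `ℂ[ε]` (Bläser's `R_15 ≤ 17`).

## Source of the decomposition

CGLV prove the bound through `T_{skewcw,2}^{⊠2} ≅ det₃` and a border Waring rank `17` expression
whose `44` parameters are algebraic numbers of degree `81` (§5.2 there), which is not practical to
re-verify inside the Lean kernel. Conner–Huang–Landsberg, *Bad and good news for Strassen's laser
method*, arXiv:2009.11391, §8 ("A simpler Waring border rank 17 expression for det₃") print instead
`17` matrices `m_s(t) ∈ ℂ[t, t⁻¹]^{3×3}` whose entries are monomials `c tᵉ` with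
`c ∈ {ζ^k} ∪ {5^{-1/6}ζ², 5^{-1/6}ζ⁸, p ζ², p ζ⁸, q ζ², q ζ⁸}`, `ζ = e^{2πi/12}`,
`p, q = (1 ± (2/5)√5)^{1/3} = (5^{1/3} ± 5^{-1/6})/2`, such that `∑ₛ m_s(t)^{⊗3} = det₃ + O(t)`, where
`det₃ ∈ (ℂ^{3×3})^{⊗3}` has entry `ε_{i₁i₂i₃} ε_{j₁j₂j₃}` at `((i₁,j₁),(i₂,j₂),(i₃,j₃))` (the polarisation
with `det₃(X,X,X) = 6 det X`; all coefficients live in `ℤ[1/10][ζ, 5^{1/6}]`).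
Multiplying every matrix by `10 t⁵` gives vectors `M_s ∈ ℤ[ζ, 5^{1/6}][t]^9` of degree `≤ 10` with
`∑ₛ M_s^{⊗3} = 1000 · t¹⁵ det₃ + O(t¹⁶)`.

## How it is checked here (everything auxiliary lives in the sub-namespace `CHL17`)

* `Z12`, `Z12S`: computable models of `ℤ[ζ]` (`ζ⁴ = ζ² − 1`, basis `1, ζ, ζ², ζ³`) and of
  `ℤ[ζ][β]` (`β⁶ = 5`, basis `1, …, β⁵`), with evaluation maps into any commutative ring that are
  additive and multiplicative at any `ζ, β` satisfying the two relations (`Z12.eval_mul`,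
  `Z12S.eval_mul`); no injectivity is needed or claimed.
* `chlMats` / `chlTable`: the `17` matrices `10 t⁵ m_s(t)` as `Option (coefficient × exponent)`.
* `T_{skewcw,2}` (`skewCwTensor ℂ 1`) is a signed relabeling of the Levi-Civita tensor:
  `T(i,j,k) = s_b(j) s_c(k) ε(i,j,γk)` with `s_b = (−1,1,1)`, `s_c = (1,1,−1)`, `γ = (1 2)`; so the
  second and third vectors of each triad are twisted accordingly (`triadOf`, `vC`, `wC`) and the check is run
  directly against `kroneckerPow (skewCwTensor ℂ 1) 2` (via the integer copy `skewZ`).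
* `checkAll` evaluates, for all `3⁶` entries and all degrees `d ≤ 15`, the degree-`d` coefficient of
  `∑ₛ U_s ⊗ V_s ⊗ W_s` in the model (`checkEntry`: the `17` monomials of an entry are formed once)
  and compares it with `1000 · T` at `d = 15` and `0` below (`lhsZ = rhsZ`, `lhsZ_eq_coeffAt`);
  `decide +kernel` certifies `checkAll = true`, and `isApproxDecomposition_chl` transports this along
  the evaluation at `ζ = (√3 + i)/2`, `β = 5^{1/6}` to an `IsApproxDecomposition 15` over `ℂ`
  (the first vector of each triad is divided by `1000`).

## References

* A. Conner, F. Gesmundo, J. M. Landsberg, E. Ventura, *Rank and border rank of Kronecker powers of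
  tensors and Strassen's laser method*, comput. complexity 31 (2022), arXiv:1909.04785, §1.3, §5.
* A. Conner, H. Huang, J. M. Landsberg, *Bad and good news for Strassen's laser method: border rank of
  perm₃ and strict submultiplicativity*, arXiv:2009.11391, §8.
-/

noncomputable section

open scoped BigOperators Polynomial

namespace Literature.Computability.AlgebraicComplexity

namespace CHL17

/-! ## A computable model of `ℤ[ζ₁₂]` -/

/-- Elements `c₀ + c₁ζ + c₂ζ² + c₃ζ³` of `ℤ[ζ]`, `ζ` a root of `X⁴ − X² + 1` (the 12th cyclotomic
polynomial), as integer quadruples. [folklore] -/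
structure Z12 where
  /-- coefficient of `1` -/
  c0 : ℤ
  /-- coefficient of `ζ` -/
  c1 : ℤ
  /-- coefficient of `ζ²` -/
  c2 : ℤ
  /-- coefficient of `ζ³` -/
  c3 : ℤ
deriving DecidableEq

namespace Z12

/-- Componentwise sum in `ℤ[ζ]`. [folklore] -/
instance : Add Z12 := ⟨fun p q => ⟨p.c0 + q.c0, p.c1 + q.c1, p.c2 + q.c2, p.c3 + q.c3⟩⟩

/-- Integer scaling in `ℤ[ζ]`. [folklore] -/
instance : SMul ℤ Z12 := ⟨fun n p => ⟨n * p.c0, n * p.c1, n * p.c2, n * p.c3⟩⟩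

/-- Product in `ℤ[ζ]`, reduced with `ζ⁴ = ζ² − 1`, `ζ⁵ = ζ³ − ζ`, `ζ⁶ = −1`. [folklore] -/
instance : Mul Z12 :=
  ⟨fun p q =>
    ⟨p.c0 * q.c0 - (p.c1 * q.c3 + p.c2 * q.c2 + p.c3 * q.c1) - p.c3 * q.c3,
     p.c0 * q.c1 + p.c1 * q.c0 - (p.c2 * q.c3 + p.c3 * q.c2),
     p.c0 * q.c2 + p.c1 * q.c1 + p.c2 * q.c0 + (p.c1 * q.c3 + p.c2 * q.c2 + p.c3 * q.c1),
     p.c0 * q.c3 + p.c1 * q.c2 + p.c2 * q.c1 + p.c3 * q.c0 + (p.c2 * q.c3 + p.c3 * q.c2)⟩⟩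

/-- `ζ^k` in the model. [folklore] -/
def zetaPow : ℕ → Z12
  | 0 => ⟨1, 0, 0, 0⟩
  | k + 1 => zetaPow k * ⟨0, 1, 0, 0⟩

variable {R : Type*} [CommRing R]

/-- Evaluation `c₀ + c₁ζ + c₂ζ² + c₃ζ³` at an element `ζ` of a commutative ring. [folklore] -/
def eval (ζ : R) (p : Z12) : R := p.c0 + p.c1 * ζ + p.c2 * ζ ^ 2 + p.c3 * ζ ^ 3

/-- `eval` is additive. [folklore] -/
theorem eval_add (ζ : R) (p q : Z12) : eval ζ (p + q) = eval ζ p + eval ζ q := by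
  change eval ζ ⟨_, _, _, _⟩ = _
  simp only [eval]
  push_cast
  ring

/-- `eval` commutes with integer scaling. [folklore] -/
theorem eval_smul (ζ : R) (n : ℤ) (p : Z12) : eval ζ (n • p) = n * eval ζ p := by
  change eval ζ ⟨_, _, _, _⟩ = _
  simp only [eval]
  push_cast
  ring

/-- `eval` is multiplicative at any root of `X⁴ − X² + 1`. [folklore] -/
theorem eval_mul {ζ : R} (hζ : ζ ^ 4 - ζ ^ 2 + 1 = 0) (p q : Z12) :
    eval ζ (p * q) = eval ζ p * eval ζ q := by
  change eval ζ ⟨_, _, _, _⟩ = _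
  simp only [eval]
  push_cast
  linear_combination (-((p.c1 * q.c3 + p.c2 * q.c2 + p.c3 * q.c1 : R) +
    (p.c2 * q.c3 + p.c3 * q.c2 : R) * ζ + (p.c3 * q.c3 : R) * (ζ ^ 2 + 1))) * hζ

/-- `0 + p = p` in the model. [folklore] -/
theorem zero_add' (p : Z12) : (⟨0, 0, 0, 0⟩ : Z12) + p = p := by
  cases p
  change Z12.mk _ _ _ _ = _
  simp

/-- `eval (zetaPow k) = ζ^k` at any root of `X⁴ − X² + 1`. [folklore] -/
theorem eval_zetaPow {ζ : R} (hζ : ζ ^ 4 - ζ ^ 2 + 1 = 0) : ∀ k, eval ζ (zetaPow k) = ζ ^ k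
  | 0 => by simp [zetaPow, eval]
  | k + 1 => by rw [zetaPow, eval_mul hζ, eval_zetaPow hζ k, pow_succ]; simp [eval]

end Z12

/-! ## A computable model of `ℤ[ζ₁₂, 5^{1/6}]` -/

/-- Elements `∑_{j<6} d_j βʲ` of `ℤ[ζ][β]`, `β⁶ = 5`, as sextuples over `Z12`. [folklore] -/
structure Z12S where
  /-- coefficient of `1` -/
  d0 : Z12
  /-- coefficient of `β` -/
  d1 : Z12
  /-- coefficient of `β²` -/
  d2 : Z12
  /-- coefficient of `β³` -/
  d3 : Z12
  /-- coefficient of `β⁴` -/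
  d4 : Z12
  /-- coefficient of `β⁵` -/
  d5 : Z12
deriving DecidableEq

namespace Z12S

/-- Zero. [folklore] -/
def zero : Z12S := ⟨⟨0, 0, 0, 0⟩, ⟨0, 0, 0, 0⟩, ⟨0, 0, 0, 0⟩, ⟨0, 0, 0, 0⟩, ⟨0, 0, 0, 0⟩, ⟨0, 0, 0, 0⟩⟩

/-- The constant `p ∈ ℤ[ζ]`. [folklore] -/
def ofZ12 (p : Z12) : Z12S := ⟨p, ⟨0, 0, 0, 0⟩, ⟨0, 0, 0, 0⟩, ⟨0, 0, 0, 0⟩, ⟨0, 0, 0, 0⟩, ⟨0, 0, 0, 0⟩⟩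

/-- The integer `n`. [folklore] -/
def ofInt (n : ℤ) : Z12S := ofZ12 ⟨n, 0, 0, 0⟩

/-- Componentwise sum in `ℤ[ζ][β]`. [folklore] -/
instance : Add Z12S :=
  ⟨fun P Q => ⟨P.d0 + Q.d0, P.d1 + Q.d1, P.d2 + Q.d2, P.d3 + Q.d3, P.d4 + Q.d4, P.d5 + Q.d5⟩⟩

/-- Integer scaling in `ℤ[ζ][β]`. [folklore] -/
instance : SMul ℤ Z12S := ⟨fun n P => ⟨n • P.d0, n • P.d1, n • P.d2, n • P.d3, n • P.d4, n • P.d5⟩⟩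

/-- Product in `ℤ[ζ][β]`, reduced with `β⁶⁺ᵐ = 5 βᵐ`. [folklore] -/
instance : Mul Z12S :=
  ⟨fun P Q =>
    ⟨P.d0 * Q.d0 + (5 : ℤ) • (P.d1 * Q.d5 + P.d2 * Q.d4 + P.d3 * Q.d3 + P.d4 * Q.d2 + P.d5 * Q.d1),
     P.d0 * Q.d1 + P.d1 * Q.d0 + (5 : ℤ) • (P.d2 * Q.d5 + P.d3 * Q.d4 + P.d4 * Q.d3 + P.d5 * Q.d2),
     P.d0 * Q.d2 + P.d1 * Q.d1 + P.d2 * Q.d0 + (5 : ℤ) • (P.d3 * Q.d5 + P.d4 * Q.d4 + P.d5 * Q.d3),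
     P.d0 * Q.d3 + P.d1 * Q.d2 + P.d2 * Q.d1 + P.d3 * Q.d0 + (5 : ℤ) • (P.d4 * Q.d5 + P.d5 * Q.d4),
     P.d0 * Q.d4 + P.d1 * Q.d3 + P.d2 * Q.d2 + P.d3 * Q.d1 + P.d4 * Q.d0 + (5 : ℤ) • (P.d5 * Q.d5),
     P.d0 * Q.d5 + P.d1 * Q.d4 + P.d2 * Q.d3 + P.d3 * Q.d2 + P.d4 * Q.d1 + P.d5 * Q.d0⟩⟩

/-- `zero + P = P` in the model. [folklore] -/
theorem zero_add (P : Z12S) : zero + P = P := by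
  cases P
  change Z12S.mk (⟨0, 0, 0, 0⟩ + _) (⟨0, 0, 0, 0⟩ + _) (⟨0, 0, 0, 0⟩ + _) (⟨0, 0, 0, 0⟩ + _)
    (⟨0, 0, 0, 0⟩ + _) (⟨0, 0, 0, 0⟩ + _) = _
  simp only [Z12.zero_add']

/-- Sum of a list. [folklore] -/
def sumList : List Z12S → Z12S
  | [] => zero
  | P :: l => P + sumList l

variable {R : Type*} [CommRing R]

/-- Evaluation `∑ⱼ d_j(ζ) βʲ`. [folklore] -/
def eval (ζ β : R) (P : Z12S) : R :=
  Z12.eval ζ P.d0 + Z12.eval ζ P.d1 * β + Z12.eval ζ P.d2 * β ^ 2 + Z12.eval ζ P.d3 * β ^ 3 +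
    Z12.eval ζ P.d4 * β ^ 4 + Z12.eval ζ P.d5 * β ^ 5

/-- `eval zero = 0`. [folklore] -/
theorem eval_zero (ζ β : R) : eval ζ β zero = 0 := by simp [eval, zero, Z12.eval]

/-- `eval (ofZ12 p) = p(ζ)`. [folklore] -/
theorem eval_ofZ12 (ζ β : R) (p : Z12) : eval ζ β (ofZ12 p) = Z12.eval ζ p := by
  simp [eval, ofZ12, Z12.eval]

/-- `eval (ofInt n) = n`. [folklore] -/
theorem eval_ofInt (ζ β : R) (n : ℤ) : eval ζ β (ofInt n) = n := by
  simp [ofInt, eval_ofZ12, Z12.eval]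

/-- `eval` is additive. [folklore] -/
theorem eval_add (ζ β : R) (P Q : Z12S) : eval ζ β (P + Q) = eval ζ β P + eval ζ β Q := by
  change eval ζ β ⟨_, _, _, _, _, _⟩ = _
  simp only [eval, Z12.eval_add]
  ring

/-- `eval` commutes with integer scaling. [folklore] -/
theorem eval_smul (ζ β : R) (n : ℤ) (P : Z12S) : eval ζ β (n • P) = n * eval ζ β P := by
  change eval ζ β ⟨_, _, _, _, _, _⟩ = _
  simp only [eval, Z12.eval_smul]
  ring

/-- `eval` of a list sum. [folklore] -/
theorem eval_sumList (ζ β : R) : ∀ l : List Z12S, eval ζ β (sumList l) = (l.map (eval ζ β)).sum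
  | [] => by simp [sumList, eval_zero]
  | P :: l => by rw [sumList, eval_add, eval_sumList ζ β l, List.map_cons, List.sum_cons]

/-- `eval` is multiplicative at any `ζ` with `ζ⁴ − ζ² + 1 = 0` and `β` with `β⁶ = 5`. [folklore] -/
theorem eval_mul {ζ β : R} (hζ : ζ ^ 4 - ζ ^ 2 + 1 = 0) (hβ : β ^ 6 = 5) (P Q : Z12S) :
    eval ζ β (P * Q) = eval ζ β P * eval ζ β Q := by
  change eval ζ β ⟨_, _, _, _, _, _⟩ = _
  simp only [eval, Z12.eval_add, Z12.eval_mul hζ, Z12.eval_smul]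
  generalize Z12.eval ζ P.d0 = p0, Z12.eval ζ P.d1 = p1, Z12.eval ζ P.d2 = p2,
    Z12.eval ζ P.d3 = p3, Z12.eval ζ P.d4 = p4, Z12.eval ζ P.d5 = p5
  generalize Z12.eval ζ Q.d0 = q0, Z12.eval ζ Q.d1 = q1, Z12.eval ζ Q.d2 = q2,
    Z12.eval ζ Q.d3 = q3, Z12.eval ζ Q.d4 = q4, Z12.eval ζ Q.d5 = q5
  push_cast
  linear_combination (-((p1 * q5 + p2 * q4 + p3 * q3 + p4 * q2 + p5 * q1) +
    (p2 * q5 + p3 * q4 + p4 * q3 + p5 * q2) * β + (p3 * q5 + p4 * q4 + p5 * q3) * β ^ 2 +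
    (p4 * q5 + p5 * q4) * β ^ 3 + p5 * q5 * β ^ 4)) * hβ

end Z12S

/-! ## The data of Conner–Huang–Landsberg 2020, §8 -/

section Data

open Z12S

/-- `10 ζ^k` as a constant of `ℤ[ζ][β]`. [cite: ConnerHuangLandsberg2020, §8] -/
def cz (k : ℕ) : Z12S := ofZ12 ((10 : ℤ) • Z12.zetaPow k)

/-- `10 · 5^{-1/6} ζ² = 2 β⁵ ζ²` (entry `(1,2)` of `m₁₆`, times `10`). [cite: ConnerHuangLandsberg2020, §8] -/
def cA2 : Z12S := ⟨⟨0, 0, 0, 0⟩, ⟨0, 0, 0, 0⟩, ⟨0, 0, 0, 0⟩, ⟨0, 0, 0, 0⟩, ⟨0, 0, 0, 0⟩,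
  (2 : ℤ) • Z12.zetaPow 2⟩

/-- `10 (1 + (2/5)√5)^{1/3} ζ² = (5β² + β⁵) ζ²` (entry `(1,3)` of `m₁₆`, times `10`).
[cite: ConnerHuangLandsberg2020, §8] -/
def cP2 : Z12S := ⟨⟨0, 0, 0, 0⟩, ⟨0, 0, 0, 0⟩, (5 : ℤ) • Z12.zetaPow 2, ⟨0, 0, 0, 0⟩, ⟨0, 0, 0, 0⟩,
  Z12.zetaPow 2⟩

/-- `10 (1 − (2/5)√5)^{1/3} ζ⁸ = (5β² − β⁵) ζ⁸` (entry `(2,1)` of `m₁₆`, times `10`).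
[cite: ConnerHuangLandsberg2020, §8] -/
def cQ8 : Z12S := ⟨⟨0, 0, 0, 0⟩, ⟨0, 0, 0, 0⟩, (5 : ℤ) • Z12.zetaPow 8, ⟨0, 0, 0, 0⟩, ⟨0, 0, 0, 0⟩,
  (-1 : ℤ) • Z12.zetaPow 8⟩

/-- `10 · 5^{-1/6} ζ⁸ = 2 β⁵ ζ⁸` (entry `(1,2)` of `m₁₇`, times `10`). [cite: ConnerHuangLandsberg2020, §8] -/
def cA8 : Z12S := ⟨⟨0, 0, 0, 0⟩, ⟨0, 0, 0, 0⟩, ⟨0, 0, 0, 0⟩, ⟨0, 0, 0, 0⟩, ⟨0, 0, 0, 0⟩,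
  (2 : ℤ) • Z12.zetaPow 8⟩

/-- `10 (1 − (2/5)√5)^{1/3} ζ² = (5β² − β⁵) ζ²` (entry `(1,3)` of `m₁₇`, times `10`).
[cite: ConnerHuangLandsberg2020, §8] -/
def cQ2 : Z12S := ⟨⟨0, 0, 0, 0⟩, ⟨0, 0, 0, 0⟩, (5 : ℤ) • Z12.zetaPow 2, ⟨0, 0, 0, 0⟩, ⟨0, 0, 0, 0⟩,
  (-1 : ℤ) • Z12.zetaPow 2⟩

/-- `10 (1 + (2/5)√5)^{1/3} ζ⁸ = (5β² + β⁵) ζ⁸` (entry `(2,1)` of `m₁₇`, times `10`).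
[cite: ConnerHuangLandsberg2020, §8] -/
def cP8 : Z12S := ⟨⟨0, 0, 0, 0⟩, ⟨0, 0, 0, 0⟩, (5 : ℤ) • Z12.zetaPow 8, ⟨0, 0, 0, 0⟩, ⟨0, 0, 0, 0⟩,
  Z12.zetaPow 8⟩

/-- The `17` matrices `10 t⁵ m_s(t)` of CHL 2020, §8 (in the printed order), entry `(i, l)` of
matrix `s` being `some (c, e)` for the monomial `c tᵉ` (`c` already multiplied by `10`, `e` already
shifted by `5`) and `none` for `0`. [cite: ConnerHuangLandsberg2020, §8] -/
def chlMats : List (Fin 3 → Fin 3 → Option (Z12S × ℕ)) :=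
  [-- m_1
    ![![some (cz 6, 0), none, none],
      ![none, some (cz 6, 5), none],
      ![none, none, some (cz 0, 10)]],
    -- m_2
    ![![some (cz 0, 0), none, none],
      ![none, some (cz 0, 5), none],
      ![none, none, none]],
    -- m_3
    ![![some (cz 6, 0), none, none],
      ![none, none, some (cz 8, 6)],
      ![none, some (cz 4, 9), none]],
    -- m_4
    ![![some (cz 4, 0), none, none],
      ![none, none, some (cz 6, 6)],
      ![none, none, none]],
    -- m_5
    ![![some (cz 5, 0), none, none],
      ![none, none, none],
      ![none, some (cz 0, 9), none]],
    -- m_6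
    ![![some (cz 3, 0), none, none],
      ![none, none, none],
      ![none, none, some (cz 0, 10)]],
    -- m_7
    ![![none, some (cz 10, 1), some (cz 8, 2)],
      ![none, none, some (cz 8, 6)],
      ![some (cz 6, 8), none, none]],
    -- m_8
    ![![none, some (cz 8, 1), some (cz 6, 2)],
      ![none, none, some (cz 6, 6)],
      ![none, none, none]],
    -- m_9
    ![![none, some (cz 0, 1), some (cz 0, 2)],
      ![none, none, none],
      ![some (cz 6, 8), none, none]],
    -- m_10
    ![![none, some (cz 6, 1), none],
      ![some (cz 6, 4), none, none],
      ![none, none, some (cz 6, 10)]],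
    -- m_11
    ![![none, some (cz 11, 1), none],
      ![none, none, none],
      ![some (cz 0, 8), none, none]],
    -- m_12
    ![![none, some (cz 9, 1), none],
      ![none, none, none],
      ![none, none, some (cz 6, 10)]],
    -- m_13
    ![![none, none, some (cz 0, 2)],
      ![some (cz 6, 4), none, none],
      ![none, some (cz 6, 9), none]],
    -- m_14
    ![![none, none, some (cz 0, 2)],
      ![none, some (cz 4, 5), none],
      ![some (cz 2, 8), some (cz 0, 9), none]],
    -- m_15
    ![![none, none, some (cz 6, 2)],
      ![none, some (cz 10, 5), none],
      ![none, none, none]],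
    -- m_16
    ![![none, some (cA2, 1), some (cP2, 2)],
      ![some (cQ8, 4), none, none],
      ![none, none, none]],
    -- m_17
    ![![none, some (cA8, 1), some (cQ2, 2)],
      ![some (cP8, 4), none, none],
      ![none, none, none]]]

/-- The same matrices indexed by `Fin 17`. [cite: ConnerHuangLandsberg2020, §8] -/
def chlTable (ρ : Fin 17) : Fin 3 → Fin 3 → Option (Z12S × ℕ) := chlMats.getD ρ fun _ _ => none

/-- `chlTable` enumerates `chlMats`. [cite: ConnerHuangLandsberg2020, §8] -/
theorem ofFn_chlTable : List.ofFn chlTable = chlMats := rfl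

/-- Entry `(i, l)` of a matrix of monomials as (coefficient, exponent); the zero entry is encoded as
`(0, 100)` (exponent `100 > 15` never reaches the checked degrees). [folklore] -/
def mEntry (M : Fin 3 → Fin 3 → Option (Z12S × ℕ)) (i l : Fin 3) : Z12S × ℕ :=
  (M i l).getD (Z12S.zero, 100)

/-- The sign `s_b = (−1, 1, 1)` of the relabeling `T_{skewcw,2}(i,j,k) = s_b(j) s_c(k) ε(i,j,γk)`.
[cite: ConnerGesmundoLandsbergVentura2022, Lemma 2.4] -/
def sgnB (j : Fin 3) : ℤ := if j = 0 then -1 else 1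

/-- The sign `s_c = (1, 1, −1)` of the relabeling. [cite: ConnerGesmundoLandsbergVentura2022, Lemma 2.4] -/
def sgnC (k : Fin 3) : ℤ := if k = 2 then -1 else 1

/-- The transposition `γ = (1 2)` of the relabeling. [cite: ConnerGesmundoLandsbergVentura2022, Lemma 2.4] -/
def gam (k : Fin 3) : Fin 3 := if k = 1 then 2 else if k = 2 then 1 else 0

/-- For one matrix `M = 10 t⁵ m_s` and one entry `((i,l),(j,m),(k,n))` of `(ℂ^{3×3})^{⊗3}`: the
exponent and the coefficient of the monomial `U_s(i,l) V_s(j,m) W_s(k,n)`, where `U_s = M`,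
`V_s(j,m) = s_b(j) s_b(m) M(j,m)` and `W_s(k,n) = s_c(k) s_c(n) M(γk, γn)` (the triad twisted along
`T_{skewcw,2}^{⊠2} ≅ det₃`). [cite: ConnerHuangLandsberg2020, §8] -/
def triadOf (M : Fin 3 → Fin 3 → Option (Z12S × ℕ)) (i l j m k n : Fin 3) : ℕ × Z12S :=
  ((mEntry M i l).2 + (mEntry M j m).2 + (mEntry M (gam k) (gam n)).2,
    (mEntry M i l).1 * ((sgnB j * sgnB m) • (mEntry M j m).1) *
      ((sgnC k * sgnC n) • (mEntry M (gam k) (gam n)).1))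

/-- Integer copy of `skewCwTensor _ 1` (same case distinction). [cite: ConnerGesmundoLandsbergVentura2022, eq. (3)] -/
def skewZ (i j k : Fin 3) : ℤ :=
  if (i = 0 ∧ j = k ∧ j ≠ 0) ∨ (j = 0 ∧ i = k ∧ i ≠ 0) then 1
  else if k = 0 ∧ 1 ≤ (i : ℕ) ∧ (i : ℕ) ≤ 1 ∧ (j : ℕ) = i + 1 then 1
  else if k = 0 ∧ 1 ≤ (j : ℕ) ∧ (j : ℕ) ≤ 1 ∧ (i : ℕ) = j + 1 then -1
  else 0

/-- The degree-`d` contribution of triad `ρ` at entry `((i,l),(j,m),(k,n))`, in the model.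
[cite: ConnerHuangLandsberg2020, §8] -/
def termZ (ρ : Fin 17) (i l j m k n : Fin 3) (d : ℕ) : Z12S :=
  if (triadOf (chlTable ρ) i l j m k n).1 = d then (triadOf (chlTable ρ) i l j m k n).2 else Z12S.zero

/-- The degree-`d` coefficient of `∑_ρ U_ρ ⊗ V_ρ ⊗ W_ρ` at entry `((i,l),(j,m),(k,n))`, in the model.
[cite: ConnerHuangLandsberg2020, §8] -/
def lhsZ (i l j m k n : Fin 3) (d : ℕ) : Z12S :=
  Z12S.sumList (List.ofFn fun ρ : Fin 17 => termZ ρ i l j m k n d)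

/-- The expected coefficient: `1000 · T_{skewcw,2}^{⊠2}` in degree `15`, zero below.
[cite: ConnerGesmundoLandsbergVentura2022, §1.3] -/
def rhsZ (i l j m k n : Fin 3) (d : ℕ) : Z12S :=
  if d = 15 then Z12S.ofInt (1000 * (skewZ i j k * skewZ l m n)) else Z12S.zero

/-- Coefficient extraction from a list of monomials (exponent, coefficient). [folklore] -/
def coeffAt : List (ℕ × Z12S) → ℕ → Z12S
  | [], _ => Z12S.zero
  | t :: L, d => if t.1 = d then t.2 + coeffAt L d else coeffAt L d

/-- `coeffAt` is the sum of the matching coefficients. [folklore] -/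
theorem coeffAt_eq_sumList (d : ℕ) :
    ∀ L : List (ℕ × Z12S), coeffAt L d = Z12S.sumList (L.map fun t => if t.1 = d then t.2 else Z12S.zero)
  | [] => rfl
  | t :: L => by
    rw [coeffAt, coeffAt_eq_sumList d L, List.map_cons, Z12S.sumList]
    split_ifs
    · rfl
    · rw [Z12S.zero_add]

/-- The check of one entry `((i,l),(j,m),(k,n))`: its `17` monomials are formed once, then every
degree `d ≤ 15` is compared with the expected coefficient. [cite: ConnerHuangLandsberg2020, §8] -/
def checkEntry (i l j m k n : Fin 3) : Bool :=
  let mons := chlMats.map fun M => triadOf M i l j m k n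
  (List.range 16).all fun d => decide (coeffAt mons d = rhsZ i l j m k n d)

/-- The whole finite check: all `3⁶` entries. [cite: ConnerHuangLandsberg2020, §8] -/
def checkAll : Bool :=
  (List.finRange 3).all fun i => (List.finRange 3).all fun l => (List.finRange 3).all fun j =>
    (List.finRange 3).all fun m => (List.finRange 3).all fun k => (List.finRange 3).all fun n =>
      checkEntry i l j m k n

/-- The kernel runs the check. [cite: ConnerHuangLandsberg2020, §8] -/
theorem checkAll_eq_true : checkAll = true := by
  decide +kernel

/-- The fast coefficient extraction agrees with the specification `lhsZ`. [folklore] -/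
theorem lhsZ_eq_coeffAt (i l j m k n : Fin 3) (d : ℕ) :
    lhsZ i l j m k n d = coeffAt (chlMats.map fun M => triadOf M i l j m k n) d := by
  rw [coeffAt_eq_sumList, lhsZ, ← ofFn_chlTable, List.map_ofFn, List.map_ofFn]
  rfl

/-- Unpacking `checkAll`: the model identity entry by entry, degree by degree.
[cite: ConnerHuangLandsberg2020, §8] -/
theorem lhsZ_eq_rhsZ (i l j m k n : Fin 3) {d : ℕ} (hd : d ≤ 15) :
    lhsZ i l j m k n d = rhsZ i l j m k n d := by
  have h := checkAll_eq_true
  simp only [checkAll, List.all_eq_true] at h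
  have h' : checkEntry i l j m k n = true :=
    h i (List.mem_finRange i) l (List.mem_finRange l) j (List.mem_finRange j)
      m (List.mem_finRange m) k (List.mem_finRange k) n (List.mem_finRange n)
  simp only [checkEntry, List.all_eq_true, decide_eq_true_eq] at h'
  rw [lhsZ_eq_coeffAt]
  exact h' d (List.mem_range.2 (by omega))

end Data

/-! ## Transport to `ℂ[ε]` -/

section Transport

open _root_.Polynomial

/-- `ζ = e^{2πi/12} = (√3 + i)/2`. [cite: ConnerHuangLandsberg2020, §8] -/
def zeta12 : ℂ := ((Real.sqrt 3 : ℝ) + Complex.I) / 2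

/-- `β = 5^{1/6} > 0`. [cite: ConnerHuangLandsberg2020, §8] -/
def beta5 : ℂ := ((5 : ℝ) ^ ((1 : ℝ) / 6) : ℝ)

/-- `ζ⁴ − ζ² + 1 = 0`. [folklore] -/
theorem zeta12_rel : zeta12 ^ 4 - zeta12 ^ 2 + 1 = 0 := by
  have h3 : ((Real.sqrt 3 : ℝ) : ℂ) ^ 2 = 3 := by
    rw [← Complex.ofReal_pow, Real.sq_sqrt (by norm_num : (0 : ℝ) ≤ 3)]
    norm_num
  have hI : Complex.I ^ 2 = -1 := Complex.I_sq
  unfold zeta12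
  linear_combination ((5 * (Complex.I ^ 2 + 1) - 4 + 4 * (Real.sqrt 3 : ℂ) * Complex.I +
      (((Real.sqrt 3 : ℝ) : ℂ) ^ 2 - 3)) / 16) * h3 +
    ((12 + 4 * (Real.sqrt 3 : ℂ) * Complex.I + (((Real.sqrt 3 : ℝ) : ℂ) ^ 2 - 3) +
      (Complex.I ^ 2 + 1)) / 16) * hI

/-- `β⁶ = 5`. [folklore] -/
theorem beta5_rel : beta5 ^ 6 = 5 := by
  unfold beta5
  rw [← Complex.ofReal_pow, ← Real.rpow_natCast, ← Real.rpow_mul (by norm_num : (0 : ℝ) ≤ 5)]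
  norm_num

/-- Evaluation of the model at `(ζ, β) = (e^{2πi/12}, 5^{1/6})`. [folklore] -/
def ev (P : Z12S) : ℂ := Z12S.eval zeta12 beta5 P

/-- First vectors `U_ρ / 1000 ∈ ℂ[ε]^{3×3}` of the decomposition (index `a : Fin 2 → Fin 3` read as the
matrix position `(a 0, a 1)`). [cite: ConnerHuangLandsberg2020, §8] -/
def uC (ρ : Fin 17) (a : Fin 2 → Fin 3) : ℂ[X] :=
  C (ev (mEntry (chlTable ρ) (a 0) (a 1)).1 / 1000) * X ^ (mEntry (chlTable ρ) (a 0) (a 1)).2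

/-- Second vectors `V_ρ(j,m) = s_b(j) s_b(m) U_ρ(j,m)`. [cite: ConnerHuangLandsberg2020, §8] -/
def vC (ρ : Fin 17) (b : Fin 2 → Fin 3) : ℂ[X] :=
  C (ev ((sgnB (b 0) * sgnB (b 1)) • (mEntry (chlTable ρ) (b 0) (b 1)).1)) *
    X ^ (mEntry (chlTable ρ) (b 0) (b 1)).2

/-- Third vectors `W_ρ(k,n) = s_c(k) s_c(n) U_ρ(γk,γn)`. [cite: ConnerHuangLandsberg2020, §8] -/
def wC (ρ : Fin 17) (c : Fin 2 → Fin 3) : ℂ[X] :=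
  C (ev ((sgnC (c 0) * sgnC (c 1)) • (mEntry (chlTable ρ) (gam (c 0)) (gam (c 1))).1)) *
    X ^ (mEntry (chlTable ρ) (gam (c 0)) (gam (c 1))).2

/-- `T_{skewcw,2}` is the cast of its integer copy. [cite: ConnerGesmundoLandsbergVentura2022, eq. (3)] -/
theorem skewCwTensor_one_eq_cast (i j k : Fin 3) : skewCwTensor ℂ 1 i j k = (skewZ i j k : ℂ) := by
  unfold skewCwTensor skewZ
  split_ifs <;> simp

/-- Entries of `T_{skewcw,2}^{⊠2}` through the integer copy. [cite: ConnerGesmundoLandsbergVentura2022, eq. (3)] -/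
theorem kroneckerPow_skewCwTensor_two (a b c : Fin 2 → Fin 3) :
    kroneckerPow (skewCwTensor ℂ 1) 2 a b c =
      ((skewZ (a 0) (b 0) (c 0) * skewZ (a 1) (b 1) (c 1) : ℤ) : ℂ) := by
  rw [kroneckerPow_apply, Fin.prod_univ_two, skewCwTensor_one_eq_cast, skewCwTensor_one_eq_cast]
  push_cast
  ring

/-- The degree-`d` coefficient of one triad is `ev (termZ …) / 1000`. [cite: ConnerHuangLandsberg2020, §8] -/
theorem coeff_triad (ρ : Fin 17) (a b c : Fin 2 → Fin 3) (d : ℕ) :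
    (uC ρ a * vC ρ b * wC ρ c).coeff d =
      ev (termZ ρ (a 0) (a 1) (b 0) (b 1) (c 0) (c 1) d) / 1000 := by
  set M := chlTable ρ with hM
  have hmul : uC ρ a * vC ρ b * wC ρ c =
      C (ev (mEntry M (a 0) (a 1)).1 / 1000 *
          ev ((sgnB (b 0) * sgnB (b 1)) • (mEntry M (b 0) (b 1)).1) *
          ev ((sgnC (c 0) * sgnC (c 1)) • (mEntry M (gam (c 0)) (gam (c 1))).1)) *
        X ^ ((mEntry M (a 0) (a 1)).2 + (mEntry M (b 0) (b 1)).2 +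
          (mEntry M (gam (c 0)) (gam (c 1))).2) := by
    simp only [uC, vC, wC, map_mul, pow_add, ← hM]
    ring
  rw [hmul, coeff_C_mul_X_pow, termZ, ← hM, triadOf]
  by_cases h : (mEntry M (a 0) (a 1)).2 + (mEntry M (b 0) (b 1)).2 +
      (mEntry M (gam (c 0)) (gam (c 1))).2 = d
  · rw [if_pos h.symm, if_pos h]
    simp only [ev, Z12S.eval_mul zeta12_rel beta5_rel]
    ring
  · rw [if_neg (Ne.symm h), if_neg h]
    simp only [ev, Z12S.eval_zero, zero_div]

/-- **The explicit order-15 approximate decomposition of `T_{skewcw,2}^{⊠2}` with 17 triads**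
(CHL 2020, §8, transported along `T_{skewcw,2}^{⊠2} ≅ det₃`). [cite: ConnerHuangLandsberg2020, §8] -/
theorem isApproxDecomposition_chl :
    IsApproxDecomposition 15 (kroneckerPow (skewCwTensor ℂ 1) 2) uC vC wC := by
  intro a b c d hd
  rw [finsetSum_coeff]
  simp only [coeff_triad]
  rw [← Finset.sum_div]
  have key := congrArg ev (lhsZ_eq_rhsZ (a 0) (a 1) (b 0) (b 1) (c 0) (c 1) hd)
  rw [lhsZ, ev, Z12S.eval_sumList, List.map_ofFn, Fin.sum_ofFn] at key
  change (∑ ρ : Fin 17, ev (termZ ρ (a 0) (a 1) (b 0) (b 1) (c 0) (c 1) d)) = _ at key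
  rw [key, rhsZ]
  split_ifs with h15
  · simp only [ev, Z12S.eval_ofInt, kroneckerPow_skewCwTensor_two]
    push_cast
    ring
  · simp only [ev, Z12S.eval_zero, zero_div]

end Transport

end CHL17

/-- `R_15(T_{skewcw,2}^{⊠2}) ≤ 17` (order-`15` approximate rank, Bläser's `R_h`), by the explicit
decomposition `CHL17.isApproxDecomposition_chl`. [cite: ConnerGesmundoLandsbergVentura2022, §1.3] -/
theorem approxRank_fifteen_skewCw2_sq_le : approxRank 15 (kroneckerPow (skewCwTensor ℂ 1) 2) ≤ 17 :=
  approxRank_le_of_isApproxDecomposition CHL17.isApproxDecomposition_chl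

/-- **CGLV 2022, §1.3 (Thm. 2.7 of the journal version): `bR(T_{skewcw,2}^{⊠2}) ≤ 17`**, discharging
the named fact `CGLV2022_borderRank_skewCw2_sq_le`. [cite: ConnerGesmundoLandsbergVentura2022, §1.3] -/
theorem CGLV2022_borderRank_skewCw2_sq_le_holds : CGLV2022_borderRank_skewCw2_sq_le :=
  (algBorderRank_le_approxRank 15 _).trans approxRank_fifteen_skewCw2_sq_le

end Literature.Computability.AlgebraicComplexity

end
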